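import Summits.BirchSwinnertonDyer.BirchSwinnertonDyer.Theorems.EdixhovenFibreFiveSevenStarredOptimalManinUnitFiveSevenLeverAtSymbols57
import Summits.BirchSwinnertonDyer.BirchSwinnertonDyer.Theorems.AdditiveKolyvaginRoadManinFrameResidueProperRTameTwistFull57
import HarnessLib

/-!
# The tame-twist lever at `p ∈ {5, 7}` RE-KEYED PER CURVE, III: Manin's `p`-part at a lattice-optimal datum off the
# Kosters–Pannekoek exception, from the body of F″ AT `(W, p)` (no universal Kato fact)

HONEST FRAMING. TOOL theorems only (no definition, no named fact, no `sorry`); nothing is closed or booked; BSD is not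
proved by any of this. Seat `bsd-line-edix-p4` g9 (route `EdixhovenFibreFiveSeven`, crux K★ stmt-BirchSwinnertonDyer-22226, line
`kato-lever`, lane (g) = memo `Cruxes/StarredOptimalManinUnitFiveSeven/Lines/kato-lever-hDR-programme.md` v3.1 §3 (g)).

WHY. The tame-twist lever of seats bsd-wall-manin-p1 g3/g4 (`ManinFrameResidueProperRTameTwist.*57`, files
`AdditiveKolyvaginRoadManinFrameResidueProperRTameTwist{Character57,Symbols57,Full57}`) takes Kato's Néron integrality as the
UNIVERSAL cite-only fact F″ `kato_neron_isIntegral_twistedSymbolSum_of_additive_five_le` (binder `hK`) but APPLIES it only at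
the one curve `W` under discussion (`hK W f hf p …`). The per-class assembly `KatoAssemblySocketAt.katoNeronBody_of_sl2NeronValues_of_isDeRhamAt`
(sibling file `…AssemblyAt`) proves exactly that instance — the BODY of F″ at `(W, p)` — from P1 ∧ (S5b-tower) ∧ Prop. 1.2.3 ∧
the de Rham-ness of `V_pW|_{Γ_{ℚ_p}}` of THIS `W` (a tree theorem on the (G)-ordinary locus). These files re-key the lever on
the PER-CURVE hypothesis `hK : <body of F″ at (W, p)>` (18 displayed lines, F″'s text with `V := W` and `p` fixed); every
proof is the parent's VERBATIM with `hK W f hf p` ↦ `hK f hf` (and the `_at` names).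

* `not_dvd_c_of_tameTwist57_at` — `ManinFrameResidueProperRTameTwist.not_dvd_c_of_tameTwist57` (p579959) per curve: `W/ℚ`
  globally minimal, additive at `p ∈ {5, 7}`, `E[p]` irreducible, `W(ℚ_p)[p] = 0`, `D` lattice-optimal at a level `N` with
  `p² ∣ N` and `a_ℓ = ±1` at `ℓ ∥ N`, AND the body of F″ at `(W, p)` ⟹ `p ∤ c(D)`.

References: [Kato2004Asterisque] (8.1.3) p. 180, Thm. 9.7 p. 189; [KimNakamura2020] Cor. 2.4; [KostersPannekoek2017] Thm. 1 and
Cor. 2; [Manin1972] Thm. 1.6; parent file's module docstring.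
-/

set_option autoImplicit false
-- the Theorems namespace of a single-conjunct summit repeats the summit name by design (D-0017)
set_option linter.dupNamespace false

noncomputable section

open scoped Classical MatrixGroups

open WeierstrassCurve NumberField Literature.NumberTheory.EllipticCurves
  Literature.NumberTheory.EllipticCurves.ModularForms
  Literature.NumberTheory.EllipticCurves.Rank1Residual
  Literature.NumberTheory.DiophantineGeometry IsDedekindDomain Rat.HeightOneSpectrum
  Summit.BirchSwinnertonDyer.Rank1Residual Summit.BirchSwinnertonDyer.Rank1Residual.Additive
  CongruenceSubgroup Complex
  Summit.BirchSwinnertonDyer.BirchSwinnertonDyer.Theorems.ManinFrameResidueProperRTameTwist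

namespace Summit.BirchSwinnertonDyer.BirchSwinnertonDyer.Theorems.ManinFrameResidueProperRTameTwistAt

section Main57

variable {p : ℕ} [hp : Fact p.Prime]

/-- **Manin's `p`-part at a lattice-optimal datum, `p ∈ {5, 7}`, off the Kosters–Pannekoek exception.**
Let `W/ℚ` be globally minimal, additive at `p ∈ {5, 7}` with `E[p]` irreducible and `W(ℚ_p)[p] = 0`, `D` a
LATTICE-OPTIMAL datum (`Λ_E = c Λ_f`) at a level `N` with `p² ∣ N`, `a_ℓ(W) = ±1` for `ℓ ∥ N`. GRANTED the
`p ≥ 5` Kato–Kosters–Pannekoek fact: `p ∤ c`. Proof = g3's `not_dvd_c_of_tameTwistL` verbatim with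
`pint_im_cuspSymbol57_at`. [cite: Kato2004Asterisque, (8.1.3) (p. 180), Thm. 9.7 (p. 189)]
[cite: KimNakamura2020, Cor. 2.4] [cite: KostersPannekoek2017, Thm. 1 and Cor. 2] -/
theorem not_dvd_c_of_tameTwist57_at (hp57 : p = 5 ∨ p = 7)
    (W : WeierstrassCurve ℚ) [W.IsElliptic] [W.IsGloballyMinimal] {N : ℕ} [NeZero N]
    (hK : ∀ {M : ℕ} [NeZero M] (g : CuspForm (Gamma0 M) 2), IsNewformOf W g → 5 ≤ p →
      ¬ W.HasGoodReductionAtPrime p → ¬ W.HasMultiplicativeReductionAtPrime p →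
      W.HasIrreducibleModPGaloisRep p → ∀ (m : ℕ) [NeZero m], m.Coprime (p * M) →
      (7 < p ∨ (Nat.Coprime (orderOf (p : ZMod m)) (p - 1) ∧
        ∀ P : (W.baseChange ℚ_[p]).toAffine.Point, p • P = 0 → P = 0)) →
      ∀ (χ : DirichletCharacter ℂ m), χ.IsPrimitive → χ ≠ 1 → ¬ p ∣ orderOf χ → ∀ (ϖ : ℚ) (r : ℂ),
      (χ.Even → (ϖ : ℝ) * W.realPeriodRat = plusPeriod g →
        (∏ ℓ ∈ M.primeFactors with ¬ ℓ ^ 2 ∣ M,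
            (((ℓ : ℂ) - (W.LFunction ℓ : ℂ) * χ (ℓ : ZMod m)) *
              ((ℓ : ℂ) - (W.LFunction ℓ : ℂ) * (χ (ℓ : ZMod m))⁻¹))) *
            twistedSymbolSum g χ = r * (plusPeriod g : ℂ) →
        ∃ s : ℕ, ¬ p ∣ s ∧ IsIntegral ℤ ((s : ℂ) * ϖ * r)) ∧
      (χ.Odd → (ϖ : ℝ) * W.imaginaryPeriodRat = minusPeriod g →
        (∏ ℓ ∈ M.primeFactors with ¬ ℓ ^ 2 ∣ M,
            (((ℓ : ℂ) - (W.LFunction ℓ : ℂ) * χ (ℓ : ZMod m)) *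
              ((ℓ : ℂ) - (W.LFunction ℓ : ℂ) * (χ (ℓ : ZMod m))⁻¹))) *
            twistedSymbolSum g χ = r * (minusPeriod g : ℂ) * Complex.I →
        ∃ s : ℕ, ¬ p ∣ s ∧ IsIntegral ℤ ((s : ℂ) * ϖ * r)))
    (D : ModularParametrizationData W N)
    (hopt : ∀ z ∈ D.L.lattice, ∃ w ∈ periodLattice D.f, z = D.c * w)
    (hPT : ∀ P : (W.baseChange ℚ_[p]).toAffine.Point, p • P = 0 → P = 0)
    (hadd : Addv W p) (hirr : Irr W p) (hpN : p ^ 2 ∣ N)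
    (ha : ∀ ℓ ∈ N.primeFactors, ¬ ℓ ^ 2 ∣ N → W.LFunction ℓ = 1 ∨ W.LFunction ℓ = -1) :
    ¬ (p : ℤ) ∣ D.c := by
  have hpP : p.Prime := hp.out
  have hp2 : p ≠ 2 := by rcases hp57 with rfl | rfl <;> norm_num
  have hc0 : D.c ≠ 0 := D.maninConstant_ne_zero_holds
  -- the period scalar `ϖ = m/|c|`
  obtain ⟨mm, -, hmm⟩ :=
    SkinnerUrban2014.exists_dvd_two_mul_imaginaryPeriodRat_eq_of_latticeEq D hopt
  set ϖ : ℚ := (mm : ℚ) / |(D.c : ℚ)| with hϖdef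
  have habs0 : |(D.c : ℝ)| ≠ 0 := abs_ne_zero.mpr (by exact_mod_cast hc0)
  have hϖ : (ϖ : ℝ) * W.imaginaryPeriodRat = minusPeriod D.f := by
    rw [hϖdef]; push_cast
    rw [div_mul_eq_mul_div, hmm]
    field_simp
  have hΩf : 0 < minusPeriod D.f :=
    IsNewform0.minusPeriod_pos_holds D.isNewformOf.1 D.isNewformOf.coeffField_eq_bot
  have hΩ : 0 < W.imaginaryPeriodRat := W.imaginaryPeriodRat_pos
  -- `Ω⁻_f/2 = Im {∞, γ∞}_f` for some `γ`
  have hmem : minusPeriod D.f / 2 ∈ imagPeriods D.f := by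
    rw [SkinnerUrban2014.imagPeriods_eq_zmultiples_of_minusPeriod_pos D.f hΩf]
    exact AddSubgroup.mem_zmultiples _
  obtain ⟨z, hz, hzim⟩ := AddSubgroup.mem_map.mp hmem
  have hz' : z ∈ (periodLattice D.f : Set ℂ) := hz
  rw [coe_periodLattice_eq_range] at hz'
  obtain ⟨γ, hγ⟩ := hz'
  have hP := pint_im_cuspSymbol57_at hK hp57 (Or.inr hPT) hadd hirr D.f D.isNewformOf hpN ha hϖ γ
  rw [hγ] at hP
  have hzim' : z.im = minusPeriod D.f / 2 := hzim
  -- `Im z / Ω = ϖ/2`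
  have hq : (((z.im : ℝ) : ℂ) / (W.imaginaryPeriodRat : ℂ)) = ((ϖ / 2 : ℚ) : ℂ) := by
    rw [hzim', ← hϖ]
    have hΩ0 : (W.imaginaryPeriodRat : ℂ) ≠ 0 := by exact_mod_cast hΩ.ne'
    push_cast
    field_simp
  rw [hq] at hP
  have hval := padicValRat_nonneg_of_pint hP
  have hϖ2 : padicValRat p (ϖ / 2) = padicValRat p ϖ := by
    have hϖ0 : ϖ ≠ 0 := by
      rintro h; rw [h, Rat.cast_zero, zero_mul] at hϖ; exact hΩf.ne' hϖ.symm
    rw [padicValRat.div hϖ0 two_ne_zero, show (2 : ℚ) = ((2 : ℕ) : ℚ) by norm_num, padicValRat.of_nat,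
      padicValNat.eq_zero_of_not_dvd (fun h ↦ hp2 ((Nat.prime_dvd_prime_iff_eq hpP Nat.prime_two).mp h))]
    simp
  rw [hϖ2, ManinFrameResidueProperRUnitTwist.padicValRat_eq_neg_of_mul_imaginaryPeriodRat_eq hp2 D hopt hϖ]
    at hval
  exact not_dvd_of_padicValRat_intCast_le_zero hc0 (by linarith)


end Main57

end Summit.BirchSwinnertonDyer.BirchSwinnertonDyer.Theorems.ManinFrameResidueProperRTameTwistAt

end
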